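import Mathlib
import Summits.Ventures.PercRepro2.PatternDownDom
import Summits.Ventures.PercRepro2.DownDomHall

/-! # The universal subset Hall (UH) on every series–parallel pattern, as a private assignment
(seat mine-b, cell pub-perc-repro2; MINE-B.md §18.1, §20.3)

`IsSP.downDom` (PatternDownDom.lean) gives down-set domination of `ν = [F_R = 1] − F_B·[F_R = 0]`
on the configuration cube of every series–parallel pattern; the Hall reading
`exists_private_targets_of_downDom` (DownDomHall.lean) turns it into the statement of record of
MINE-B.md §18.1(a): **every configuration `γ` with `F_R(γ) = 0` and `F_B(γ) = a ≥ 1` owns `a`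
private configurations `γ′ ⊆ γ` with `F_R(γ′) = 1`** — an injective map on the slots
`(γ, i < F_B γ)`. -/

namespace Summit.Ventures.PercRepro2.V2Closure

open Finset
open Summit.Ventures.PercRepro2.UHClosure

variable {V : Type*} {E : Type*} [DecidableEq V] [DecidableEq E] [Fintype E]

/-- **(UH) on every series–parallel pattern as a private assignment**: every `γ` with `F_R(γ) = 0`,
`F_B(γ) ≥ 1` owns `F_B(γ)` private configurations `γ′ ⊆ γ` with `F_R(γ′) = 1` (an injective map on
the slots `(γ, i < F_B γ)`). -/
theorem IsSP.exists_private_red_targets {ends : E → Sym2 V} {s t : V} {O Y : Finset E}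
    (h : IsSP ends s t O Y) :
    ∃ f : SlotD (rLabP ends s t O Y) (bLabP ends s t O Y) → Conf Y,
      Function.Injective f ∧ ∀ p, (f p).1 ⊆ p.1.1.1.1 ∧ rLabP ends s t O Y (f p) = 1 := by
  classical
  obtain ⟨f, hf, hspec⟩ := exists_private_targets_of_downDom (rLabP ends s t O Y) (bLabP ends s t O Y)
    h.downDom
  exact ⟨f, hf, fun p => ⟨(hspec p).1, (hspec p).2⟩⟩

end Summit.Ventures.PercRepro2.V2Closure
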